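/-
Copyright (c) 2026 the pub-hodgecm-mathlib formalisation cell (harness21).  Prover seat hodgecm-mathlib-K2E1-p15 (g0), Track B ∕ K2-LIT «5Res (c)∕(d)», h413 = `stmt-HodgeConjecture-24833`,
line `K2_E1_TraceFormulaBeta`, route of record `HCCMUnconditional`; dealer K2E1-plan (g7) deal (131) «(d)-assembly owner», STEP 1: the general-box edition of ★ p859658 ∕ ★ p859688
(REPORT-FIRST `K2/STATUS.md` 2026-09-04T11:37Z) — the actual pole-exclusion domain `(D⁺ ∩ D_n ∩ U) ∖ P` does not contain the literal sub-tube boxes.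
-/
import Summits.HodgeConjecture.HodgeConjecture.Theorems.K2E1ChiMaassSelbergContinuedModelsCMTwo   -- ★ p859688 (this seat): `le_of_twoTerm`, `real_mul_inner_self`, `differentiableOn_inner_conj_comp`; brings ★ p859658 §1 holomorphy, ★ PairingCMTwo, ★ PoleControl
import HarnessLib

/-!
# K2·E1 — `K2E1ChiMaassSelbergContinuedOnBoxesCMTwo`: POLE CONTROL OF THE CONTINUED INTERTWINING OPERATOR `M(z, χ)` OF `U(1,1)_{L∕L⁺}` ON AN OPEN PRECONNECTED `D₁ ⊆ D⁺`
# CONTAINING TWO GENERAL SUB-TUBE BOXES — the `_on'` editions of ★ `K2E1ChiMaassSelbergContinuedCMTwo` ∕ ★ `…ModelsCMTwo` (twin of ★ `K2E1MaassSelbergContinuedOnBoxesCMTwo`)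

Track B ∕ K2-LIT, crux h413 = `stmt-HodgeConjecture-24833`; cell `hodgecm-mathlib`, squad K2, ENGINE E1, campaign «5Res», road «BL-2(χ,τ) ∘ MS-2(χ,τ) ∘ ARCH-UNITARITY ∘ R8₂»;
dealer K2E1-plan (g7) deal (131) STEP 1.  THEOREMS ONLY (no `def`, no `instance`, no notation, no named-fact hypothesis, no `sorry`); lane `--kind proof --supports
stmt-HodgeConjecture-24833 --as helper` (count-neutral).  Closes no socket.

WHY ([MoeglinWaldspurger1995, IV.3.12 (a)]).  Pole EXCLUSION must be run with the poles allowed: the `(χ,τ)` family `[Λ^T Ẽ(φ, z)]` (row 15) and the operator `M(z, χ)` are holomorphic on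
`D₁ := (D⁺ ∩ D_n ∩ U) ∖ P` (`U` the co-discrete per-ball holomorphy set of the B–L solution, `P` the closed countable pole set; ★ `K2E1SphericalEisensteinPoleExclusionCMTwo` for the spherical
line).  `D₁` is open and preconnected (open convex minus countable, ★ `isPreconnected_convex_diff_of_countable`) but need NOT contain the literal boxes `{3 < Re < 4, 0 < Im}`, `{1 < Re < 2,
0 < Im}` of ★ p859658's binders `hbox₁ hbox₂`.  This file re-proves the heads with the boxes as DATA: `O₁, O₂' ⊆ D₁` open non-empty with `1 < Re z′ < Re z` for `z ∈ O₁`, `z′ ∈ O₂'`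
(VERBATIM the binders of ★ `poleControl_continued_cm_two_of_pairing_on'`); the identity theorem runs on `O₁ × conj⁻¹ O₂'`.  Everything else is ★ p859658 ∕ p859688 by name.

* §1 **`diag_eq_fourBracket_of_pairing_on'`**, **`poleControl_continued_chi_cm_two_of_pairing_on'`** (bracket letters; (a1)∧(a2)∧(a3) for `b(z)` at every `z ∈ D₁`).
* §2 **`poleControl_continued_chi_cm_two_of_family_on'`** (`F : ℂ → H`), **`…_of_truncatedFamily_on'`** (`F : ℂ → L²(X, μ)`, `hFtube`, socket `h4` = ★ row 14 F1 `K2E1ChiMaassSelbergCMTwo`).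
* §3 **`normSq_le_of_family_offDual_on'`** (`χ ≠ χʷ`: the two-term relation gives `κm‖ψ z‖² ≤ T^{4x}·κm‖φ‖²` on `D₁` — no pole at all).

HONEST LABEL: HC_CM is proved only modulo the 7 printed citations (2 remaining named inputs: hLiu418 = `stmt-HodgeConjecture-24832`, h413 = `stmt-HodgeConjecture-24833`) until rung 0
closes; this file asserts no named fact, is conditional by construction on the relation letters (`hrel` ∕ `h4`), and closes no socket.

## References
* [MoeglinWaldspurger1995] C. Mœglin, J.-L. Waldspurger, *Spectral decomposition and Eisenstein series* (1995), IV.2.3, IV.3.12 (a).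
* [Arthur1980TraceFormulaII] J. Arthur, *A trace formula for reductive groups II*, Compositio Math. 40 (1980), §4.
* [BernsteinLapid2019] J. Bernstein, E. Lapid, *On the meromorphic continuation of Eisenstein series*, J. AMS 37 (2024), Thm 2.3, §4.
-/

set_option autoImplicit false
set_option linter.dupNamespace false  -- the mandated namespace repeats the summit's segment (`HodgeConjecture.HodgeConjecture`)

noncomputable section

open MeasureTheory Measure NumberField IsDedekindDomain Set Filter Topology
open scoped ENNReal NNReal ComplexConjugate InnerProductSpace
open Literature.NumberTheory.Automorphic Literature.NumberTheory.Automorphic.UnitaryGroup AdelicGroupData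
open Summit.HodgeConjecture.HodgeConjecture.Cruxes.H413.K2E1BorelEisensteinU
open Summit.HodgeConjecture.HodgeConjecture.Cruxes.H413.K2E1MaassSelbergPoleControl (poleControl_of_fourTerm)
open Summit.HodgeConjecture.HodgeConjecture.Cruxes.H413.K2E1MaassSelbergPoleControlCMTwo (add_conj_sub_one_eq)
open Summit.HodgeConjecture.HodgeConjecture.Cruxes.H413.K2E1MaassSelbergContinuedCMTwo (differentiableOn_conj_comp_conj eqOn_prod_of_separately_differentiableOn add_sub_one_ne_zero_and_sub_ne_zero)
open Summit.HodgeConjecture.HodgeConjecture.Cruxes.H413.K2E1MaassSelbergPairingCMTwo (pairing_of_differentiableOn)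
open Summit.HodgeConjecture.HodgeConjecture.Cruxes.H413.K2E1ChiMaassSelbergContinuedCMTwo (differentiableOn_fourBracket_fst_on differentiableOn_fourBracket_snd_conj_on)
open Summit.HodgeConjecture.HodgeConjecture.Cruxes.H413.K2E1ChiMaassSelbergContinuedModelsCMTwo (le_of_twoTerm real_mul_inner_self differentiableOn_inner_conj_comp)

namespace Summit.HodgeConjecture.HodgeConjecture.Cruxes.H413.K2E1ChiMaassSelbergContinuedOnBoxesCMTwo

/-! ## §1 The continued relation on the diagonal and the bracket-letter head, general boxes -/

section Head

/-- **THE `(χ, τ)` MAASS–SELBERG RELATION CONTINUED TO `D₁ × D₁` AND READ ON THE DIAGONAL — GENERAL-BOX EDITION.**  `D₁ ⊆ D⁺` open preconnected containing two open non-empty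
`O₁`, `O₂'` with `1 < Re z′ < Re z` for `z ∈ O₁`, `z′ ∈ O₂'` (e.g. `D₁ = (D⁺ ∩ D_n ∩ U) ∖ P`, boxes picked by density of the countable complement); `T > 0`; bracket letters `B₁ ∈ ℂ`,
`B₂` (`w ↦ B₂(conj w)` holomorphic on `conj⁻¹ D₁`), `B₃` (holomorphic on `D₁`), `B₄` (holomorphic in `z ∈ D₁`, `w ↦ B₄(z, conj w)` holomorphic on `conj⁻¹ D₁`); a pairing `Φ` holomorphic
in `z ∈ D₁`, `w ↦ Φ z (conj w)` holomorphic on `conj⁻¹ D₁`, equal to `R(z, z′; B)` on the sub-tube `1 < Re z′ < Re z` inside `D₁ × D₁`.  THEN `Φ(z, z) = R(z, z; B)` at EVERY `z ∈ D₁`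
(★ `eqOn_prod_of_separately_differentiableOn` on `D₁ × conj⁻¹D₁` from `O₁ × conj⁻¹O₂'`, ★ §1 holomorphy of p859658, then the diagonal `w = conj z`).  No positivity letter is used.
[cite: MoeglinWaldspurger1995, IV.3.12 (a)] [cite: Arthur1980TraceFormulaII, §4] -/
theorem diag_eq_fourBracket_of_pairing_on' {D₁ : Set ℂ} (hD₁ : IsOpen D₁) (hD₁c : IsPreconnected D₁) (hD₁sub : D₁ ⊆ {z : ℂ | 1 / 2 < z.re ∧ 0 < z.im})
    {O₁ O₂' : Set ℂ} (hO₁ : IsOpen O₁) (hO₁ne : O₁.Nonempty) (hO₁D : O₁ ⊆ D₁) (hO₂' : IsOpen O₂') (hO₂'ne : O₂'.Nonempty) (hO₂'D : O₂' ⊆ D₁)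
    (hsep : ∀ z ∈ O₁, ∀ z' ∈ O₂', 1 < z'.re ∧ z'.re < z.re)
    {T : ℝ} (hT0 : 0 < T) {cμ K : ℝ}
    {B₁ : ℂ} {B₂ B₃ : ℂ → ℂ} {B₄ : ℂ → ℂ → ℂ} (hB₂ : DifferentiableOn ℂ (fun w : ℂ => B₂ (conj w)) {w : ℂ | conj w ∈ D₁}) (hB₃ : DifferentiableOn ℂ B₃ D₁)
    (hB₄₁ : ∀ z' ∈ D₁, DifferentiableOn ℂ (fun z : ℂ => B₄ z z') D₁) (hB₄₂ : ∀ z ∈ D₁, DifferentiableOn ℂ (fun w : ℂ => B₄ z (conj w)) {w : ℂ | conj w ∈ D₁})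
    {Φ : ℂ → ℂ → ℂ}
    (hΦ₁ : ∀ z' ∈ D₁, DifferentiableOn ℂ (fun z : ℂ => Φ z z') D₁)
    (hΦ₂ : ∀ z ∈ D₁, DifferentiableOn ℂ (fun w : ℂ => Φ z (conj w)) {w : ℂ | conj w ∈ D₁})
    (hrel : ∀ z ∈ D₁, ∀ z' ∈ D₁, 1 < z'.re → z'.re < z.re →
      Φ z z' = ((cμ : ℝ) : ℂ) * (((K : ℝ) : ℂ) *
        ((((T : ℝ) : ℂ) ^ (z + conj z' - 1) / (z + conj z' - 1)) * B₁
          + (((T : ℝ) : ℂ) ^ (z - conj z') / (z - conj z')) * B₂ z'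
          - (((T : ℝ) : ℂ) ^ (-(z - conj z')) / (z - conj z')) * B₃ z
          - (((T : ℝ) : ℂ) ^ (-(z + conj z' - 1)) / (z + conj z' - 1)) * B₄ z z')))
    {z : ℂ} (hzD : z ∈ D₁) :
    Φ z z = ((cμ : ℝ) : ℂ) * (((K : ℝ) : ℂ) *
        ((((T : ℝ) : ℂ) ^ (z + conj z - 1) / (z + conj z - 1)) * B₁
          + (((T : ℝ) : ℂ) ^ (z - conj z) / (z - conj z)) * B₂ z
          - (((T : ℝ) : ℂ) ^ (-(z - conj z)) / (z - conj z)) * B₃ z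
          - (((T : ℝ) : ℂ) ^ (-(z + conj z - 1)) / (z + conj z - 1)) * B₄ z z)) := by
  -- (1) the identity on `D₁ × conj⁻¹D₁` in the variables `(z, w = conj z′)`
  set F : ℂ → ℂ → ℂ := fun z w => Φ z (conj w) with hF_def
  set G : ℂ → ℂ → ℂ := fun z w =>
      ((cμ : ℝ) : ℂ) * (((K : ℝ) : ℂ) *
        ((((T : ℝ) : ℂ) ^ (z + w - 1) / (z + w - 1)) * B₁
          + (((T : ℝ) : ℂ) ^ (z - w) / (z - w)) * B₂ (conj w)
          - (((T : ℝ) : ℂ) ^ (-(z - w)) / (z - w)) * B₃ z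
          - (((T : ℝ) : ℂ) ^ (-(z + w - 1)) / (z + w - 1)) * B₄ z (conj w))) with hG_def
  -- `D₂ := conj⁻¹ D₁` is open and preconnected
  have hD₂ : IsOpen {w : ℂ | conj w ∈ D₁} := hD₁.preimage Complex.continuous_conj
  have hD₂c : IsPreconnected {w : ℂ | conj w ∈ D₁} := by
    have h1 : {w : ℂ | conj w ∈ D₁} = (fun z : ℂ => conj z) '' D₁ := by
      ext w
      refine ⟨fun hw => ⟨conj w, hw, Complex.conj_conj w⟩, ?_⟩
      rintro ⟨z, hz1, rfl⟩
      show conj (conj z) ∈ D₁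
      rw [Complex.conj_conj]; exact hz1
    rw [h1]
    exact hD₁c.image _ Complex.continuous_conj.continuousOn
  have hconjD : ∀ w ∈ {w : ℂ | conj w ∈ D₁}, conj w ∈ D₁ := fun w hw => hw
  have hF₁ : ∀ w ∈ {w : ℂ | conj w ∈ D₁}, DifferentiableOn ℂ (fun z => F z w) D₁ := fun w hw => hΦ₁ (conj w) (hconjD w hw)
  have hG₁ : ∀ w ∈ {w : ℂ | conj w ∈ D₁}, DifferentiableOn ℂ (fun z => G z w) D₁ := fun w hw => by
    have h := differentiableOn_fourBracket_fst_on hD₁sub (cμ := cμ) (K := K) (B₁ := B₁) (B₂ := B₂) hT0 hB₃ (hD₁sub (hconjD w hw)) (hB₄₁ (conj w) (hconjD w hw))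
    simp only [Complex.conj_conj] at h
    exact h
  have hF₂ : ∀ z ∈ D₁, DifferentiableOn ℂ (fun w => F z w) {w : ℂ | conj w ∈ D₁} := fun z hz => hΦ₂ z hz
  have hG₂ : ∀ z ∈ D₁, DifferentiableOn ℂ (fun w => G z w) {w : ℂ | conj w ∈ D₁} := fun z hz =>
    differentiableOn_fourBracket_snd_conj_on hD₁sub (cμ := cμ) (K := K) (B₁ := B₁) (B₃ := B₃) hT0 hB₂ (hD₁sub hz) (hB₄₂ z hz)
  -- the boxes: `O₁ ⊆ D₁`, `O₂ := conj⁻¹ O₂' ⊆ D₂`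
  have hO₂ : IsOpen {w : ℂ | conj w ∈ O₂'} := hO₂'.preimage Complex.continuous_conj
  have hO₂ne : ({w : ℂ | conj w ∈ O₂'} : Set ℂ).Nonempty := by
    obtain ⟨z', hz'⟩ := hO₂'ne
    exact ⟨conj z', show conj (conj z') ∈ O₂' by rw [Complex.conj_conj]; exact hz'⟩
  have hO₂D : {w : ℂ | conj w ∈ O₂'} ⊆ {w : ℂ | conj w ∈ D₁} := fun w hw => hO₂'D hw
  have heq : ∀ z ∈ O₁, ∀ w ∈ {w : ℂ | conj w ∈ O₂'}, F z w = G z w := by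
    intro z hz w hw
    obtain ⟨h1, h2⟩ := hsep z hz (conj w) hw
    have h := hrel z (hO₁D hz) (conj w) (hO₂'D hw) h1 h2
    simp only [Complex.conj_conj] at h
    exact h
  have hid := eqOn_prod_of_separately_differentiableOn hD₁ hD₁c hD₂ hD₂c hO₁ hO₁ne hO₁D hO₂ hO₂ne hO₂D hF₁ hG₁ hF₂ hG₂ heq
  -- (2) the diagonal `w = conj z`
  have hzc : conj z ∈ {w : ℂ | conj w ∈ D₁} := by
    show conj (conj z) ∈ D₁
    rw [Complex.conj_conj]; exact hzD
  have hdiag := hid z hzD (conj z) hzc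
  simp only [hF_def, hG_def, Complex.conj_conj] at hdiag
  exact hdiag

/-- **POLE CONTROL OF THE CONTINUED INTERTWINING OPERATOR FROM THE `(χ, τ)` MAASS–SELBERG RELATION, IN BRACKET LETTERS, ON AN OPEN PRECONNECTED `D₁ ⊆ D⁺` CONTAINING TWO
SUB-TUBE BOXES `O₁`, `O₂'` — GENERAL-BOX EDITION** (the `(χ,τ)` twin of ★ `poleControl_continued_cm_two_of_pairing_on'`).  Letters: `T ≥ 1`, `cμ, K > 0`; brackets `B₁ = a > 0` (`⟨φ, φ⟩`, a real cast — the side condition `hB₁`), `b ≥ 0` on `D₁` (`‖M(z)φ‖²`),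
`B₂` with `w ↦ B₂(conj w)` holomorphic on `conj⁻¹ D₁` (`⟨φ, M(z′)φ⟩`, `≡ 0` off the self-dual case), `B₃` holomorphic on `D₁` with `B₃ = conj B₂` there (`⟨M(z)φ, φ⟩`), `B₄` holomorphic
in `z ∈ D₁`, with `w ↦ B₄(z, conj w)` holomorphic on `conj⁻¹ D₁` and `B₄(z, z) = b(z)` (`⟨M(z)φ, M(z′)φ⟩`), Cauchy–Schwarz `‖B₂ z‖² ≤ a·b z`; a pairing `Φ` — to be
`⟨Λ^TẼ(φ, z), Λ^TẼ(φ, z′)⟩_{L²(X)}` — holomorphic in `z ∈ D₁`, `w ↦ Φ z (conj w)` holomorphic on `conj⁻¹ D₁`, equal to `R(z, z′; B)` on the sub-tube `1 < Re z′ < Re z` inside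
`D₁ × D₁`, and real `≥ 0` on the diagonal.  THEN at every `z ∈ D₁` (`x = Re z − ½`, `y = Im z`): (a1) `√b(z) ≤ x·T^{2x}·√a∕|y| + √(x²T^{4x}a∕y² + aT^{4x})`, (a2) the box bound,
(a3) `b(z) ≤ (…)²∕y²` for `|y| ≤ 1` — [MW] IV.3.12 (a) for the OPERATOR `M(z, χ)` tested on `φ` (`diag_eq_fourBracket_of_pairing_on'`, then ★ `poleControl_of_fourTerm` with `W = B₂ z`).
[cite: MoeglinWaldspurger1995, IV.2.3, IV.3.12 (a)] [cite: Arthur1980TraceFormulaII, §4] -/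
theorem poleControl_continued_chi_cm_two_of_pairing_on' {D₁ : Set ℂ} (hD₁ : IsOpen D₁) (hD₁c : IsPreconnected D₁) (hD₁sub : D₁ ⊆ {z : ℂ | 1 / 2 < z.re ∧ 0 < z.im})
    {O₁ O₂' : Set ℂ} (hO₁ : IsOpen O₁) (hO₁ne : O₁.Nonempty) (hO₁D : O₁ ⊆ D₁) (hO₂' : IsOpen O₂') (hO₂'ne : O₂'.Nonempty) (hO₂'D : O₂' ⊆ D₁)
    (hsep : ∀ z ∈ O₁, ∀ z' ∈ O₂', 1 < z'.re ∧ z'.re < z.re)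
    {T cμ K : ℝ} (hT : 1 ≤ T) (hcμ : 0 < cμ) (hK : 0 < K) {a : ℝ} (ha : 0 < a) {b : ℂ → ℝ} (hb : ∀ z ∈ D₁, 0 ≤ b z)
    {B₁ : ℂ} {B₂ B₃ : ℂ → ℂ} {B₄ : ℂ → ℂ → ℂ} (hB₁ : B₁ = ((a : ℝ) : ℂ)) (hB₂ : DifferentiableOn ℂ (fun w : ℂ => B₂ (conj w)) {w : ℂ | conj w ∈ D₁}) (hB₃ : DifferentiableOn ℂ B₃ D₁)
    (hB₃₂ : ∀ z ∈ D₁, B₃ z = conj (B₂ z)) (hB₄₁ : ∀ z' ∈ D₁, DifferentiableOn ℂ (fun z : ℂ => B₄ z z') D₁)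
    (hB₄₂ : ∀ z ∈ D₁, DifferentiableOn ℂ (fun w : ℂ => B₄ z (conj w)) {w : ℂ | conj w ∈ D₁}) (hB₄d : ∀ z ∈ D₁, B₄ z z = ((b z : ℝ) : ℂ))
    (hCS : ∀ z ∈ D₁, ‖B₂ z‖ ^ 2 ≤ a * b z)
    {Φ : ℂ → ℂ → ℂ}
    (hΦ₁ : ∀ z' ∈ D₁, DifferentiableOn ℂ (fun z : ℂ => Φ z z') D₁)
    (hΦ₂ : ∀ z ∈ D₁, DifferentiableOn ℂ (fun w : ℂ => Φ z (conj w)) {w : ℂ | conj w ∈ D₁})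
    (hrel : ∀ z ∈ D₁, ∀ z' ∈ D₁, 1 < z'.re → z'.re < z.re →
      Φ z z' = ((cμ : ℝ) : ℂ) * (((K : ℝ) : ℂ) *
        ((((T : ℝ) : ℂ) ^ (z + conj z' - 1) / (z + conj z' - 1)) * B₁
          + (((T : ℝ) : ℂ) ^ (z - conj z') / (z - conj z')) * B₂ z'
          - (((T : ℝ) : ℂ) ^ (-(z - conj z')) / (z - conj z')) * B₃ z
          - (((T : ℝ) : ℂ) ^ (-(z + conj z' - 1)) / (z + conj z' - 1)) * B₄ z z')))
    {Q : ℂ → ℝ} (hQ : ∀ z ∈ D₁, 0 ≤ Q z ∧ Φ z z = ((Q z : ℝ) : ℂ))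
    {z : ℂ} (hzD : z ∈ D₁) :
    Real.sqrt (b z) ≤ (z.re - 1 / 2) * T ^ (2 * (z.re - 1 / 2)) * Real.sqrt a / |z.im| +
        Real.sqrt ((z.re - 1 / 2) ^ 2 * T ^ (4 * (z.re - 1 / 2)) * a / z.im ^ 2 + a * T ^ (4 * (z.re - 1 / 2))) ∧
      (∀ {x₁ x₂ η : ℝ}, 0 < x₁ → (z.re - 1 / 2) ∈ Set.Icc x₁ x₂ → 0 < η → η ≤ |z.im| →
        b z ≤ (x₂ * T ^ (2 * x₂) * Real.sqrt a / η + Real.sqrt (x₂ ^ 2 * T ^ (4 * x₂) * a / η ^ 2 + a * T ^ (4 * x₂))) ^ 2) ∧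
      (|z.im| ≤ 1 → b z ≤ ((z.re - 1 / 2) * T ^ (2 * (z.re - 1 / 2)) * Real.sqrt a +
        Real.sqrt ((z.re - 1 / 2) ^ 2 * T ^ (4 * (z.re - 1 / 2)) * a + a * T ^ (4 * (z.re - 1 / 2)))) ^ 2 / z.im ^ 2) := by
  have hT0 : 0 < T := lt_of_lt_of_le one_pos hT
  have hz : z ∈ {z : ℂ | 1 / 2 < z.re ∧ 0 < z.im} := hD₁sub hzD
  have hdiag := diag_eq_fourBracket_of_pairing_on' hD₁ hD₁c hD₁sub hO₁ hO₁ne hO₁D hO₂' hO₂'ne hO₂'D hsep hT0 hB₂ hB₃ hB₄₁ hB₄₂ hΦ₁ hΦ₂ hrel hzD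
  obtain ⟨hQ0, hQeq⟩ := hQ z hzD
  rw [hQeq] at hdiag
  -- ★ `poleControl_of_fourTerm` with `c₁ = cμ`, `c₂ = K`, `W = B₂ z`, `B₁ = a`, `B₃ = conj W`, `B₄ = b z`
  have hx : 0 < z.re - 1 / 2 := by linarith [hz.1]
  have hy : z.im ≠ 0 := ne_of_gt hz.2
  obtain ⟨hs₁, hs₂⟩ := add_conj_sub_one_eq z
  exact poleControl_of_fourTerm hcμ hK hT hx hy hQ0 ha (hb z hzD) (hCS z hzD) hs₁ hs₂ hB₁ (hB₃₂ z hzD) (hB₄d z hzD) hdiag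

end Head

/-! ## §2 Family forms, general boxes -/

section Family

/-- **[MW] IV.3.12 (a) FOR `M(z, χ)` FROM A HILBERT-SPACE-VALUED HOLOMORPHIC FAMILY ON `D₁`** — GENERAL-BOX EDITION (the `(χ,τ)` twin of ★ `poleControl_continued_cm_two_of_family_on'`):
`D₁ ⊆ D⁺` open preconnected ⊇ two sub-tube boxes `O₁`, `O₂'`; bracket letters as in §2; `F : ℂ → H` holomorphic on `D₁` into a complex inner-product space (to be `z ↦ [Λ^T Ẽ(φ, z)] ∈ L²(X, μ)`)
with `⟪F z′, F z⟫ = R(z, z′; B)` on the sub-tube `1 < Re z′ < Re z` inside `D₁ × D₁`.  THEN (a1)∧(a2)∧(a3) for `b` at every `z ∈ D₁` (★ `pairing_of_differentiableOn` supplies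
`hΦ₁ hΦ₂ hQ` for `Φ z z′ := ⟪F z′, F z⟫`, `Q z = ‖F z‖²`). [cite: MoeglinWaldspurger1995, IV.3.12 (a)] [cite: BernsteinLapid2019, §4] [cite: Arthur1980TraceFormulaII, §4] -/
theorem poleControl_continued_chi_cm_two_of_family_on' {D₁ : Set ℂ} (hD₁ : IsOpen D₁) (hD₁c : IsPreconnected D₁) (hD₁sub : D₁ ⊆ {z : ℂ | 1 / 2 < z.re ∧ 0 < z.im})
    {O₁ O₂' : Set ℂ} (hO₁ : IsOpen O₁) (hO₁ne : O₁.Nonempty) (hO₁D : O₁ ⊆ D₁) (hO₂' : IsOpen O₂') (hO₂'ne : O₂'.Nonempty) (hO₂'D : O₂' ⊆ D₁)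
    (hsep : ∀ z ∈ O₁, ∀ z' ∈ O₂', 1 < z'.re ∧ z'.re < z.re)
    {T cμ K : ℝ} (hT : 1 ≤ T) (hcμ : 0 < cμ) (hK : 0 < K) {a : ℝ} (ha : 0 < a) {b : ℂ → ℝ} (hb : ∀ z ∈ D₁, 0 ≤ b z)
    {B₁ : ℂ} {B₂ B₃ : ℂ → ℂ} {B₄ : ℂ → ℂ → ℂ} (hB₁ : B₁ = ((a : ℝ) : ℂ)) (hB₂ : DifferentiableOn ℂ (fun w : ℂ => B₂ (conj w)) {w : ℂ | conj w ∈ D₁}) (hB₃ : DifferentiableOn ℂ B₃ D₁)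
    (hB₃₂ : ∀ z ∈ D₁, B₃ z = conj (B₂ z)) (hB₄₁ : ∀ z' ∈ D₁, DifferentiableOn ℂ (fun z : ℂ => B₄ z z') D₁)
    (hB₄₂ : ∀ z ∈ D₁, DifferentiableOn ℂ (fun w : ℂ => B₄ z (conj w)) {w : ℂ | conj w ∈ D₁}) (hB₄d : ∀ z ∈ D₁, B₄ z z = ((b z : ℝ) : ℂ))
    (hCS : ∀ z ∈ D₁, ‖B₂ z‖ ^ 2 ≤ a * b z)
    {H : Type*} [NormedAddCommGroup H] [InnerProductSpace ℂ H] (F : ℂ → H) (hFd : DifferentiableOn ℂ F D₁)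
    (hrel : ∀ z ∈ D₁, ∀ z' ∈ D₁, 1 < z'.re → z'.re < z.re →
      ⟪F z', F z⟫_ℂ = ((cμ : ℝ) : ℂ) * (((K : ℝ) : ℂ) *
        ((((T : ℝ) : ℂ) ^ (z + conj z' - 1) / (z + conj z' - 1)) * B₁
          + (((T : ℝ) : ℂ) ^ (z - conj z') / (z - conj z')) * B₂ z'
          - (((T : ℝ) : ℂ) ^ (-(z - conj z')) / (z - conj z')) * B₃ z
          - (((T : ℝ) : ℂ) ^ (-(z + conj z' - 1)) / (z + conj z' - 1)) * B₄ z z')))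
    {z : ℂ} (hz : z ∈ D₁) :
    Real.sqrt (b z) ≤ (z.re - 1 / 2) * T ^ (2 * (z.re - 1 / 2)) * Real.sqrt a / |z.im| +
        Real.sqrt ((z.re - 1 / 2) ^ 2 * T ^ (4 * (z.re - 1 / 2)) * a / z.im ^ 2 + a * T ^ (4 * (z.re - 1 / 2))) ∧
      (∀ {x₁ x₂ η : ℝ}, 0 < x₁ → (z.re - 1 / 2) ∈ Set.Icc x₁ x₂ → 0 < η → η ≤ |z.im| →
        b z ≤ (x₂ * T ^ (2 * x₂) * Real.sqrt a / η + Real.sqrt (x₂ ^ 2 * T ^ (4 * x₂) * a / η ^ 2 + a * T ^ (4 * x₂))) ^ 2) ∧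
      (|z.im| ≤ 1 → b z ≤ ((z.re - 1 / 2) * T ^ (2 * (z.re - 1 / 2)) * Real.sqrt a +
        Real.sqrt ((z.re - 1 / 2) ^ 2 * T ^ (4 * (z.re - 1 / 2)) * a + a * T ^ (4 * (z.re - 1 / 2)))) ^ 2 / z.im ^ 2) := by
  obtain ⟨hΦ₁, hΦ₂, hQ⟩ := pairing_of_differentiableOn hD₁ hFd
  exact poleControl_continued_chi_cm_two_of_pairing_on' hD₁ hD₁c hD₁sub hO₁ hO₁ne hO₁D hO₂' hO₂'ne hO₂'D hsep hT hcμ hK ha hb hB₁ hB₂ hB₃ hB₃₂ hB₄₁ hB₄₂ hB₄d hCS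
    (Φ := fun z z' => ⟪F z', F z⟫_ℂ) hΦ₁ hΦ₂ hrel (Q := fun z => ‖F z‖ ^ 2) hQ hz

variable (L : Type) [Field L] [NumberField L] [IsCMField L]
variable [MeasurableSpace (quasiSplit (↥(maximalRealSubfield L)) L (IsCMField.complexConj L) 2).Adelic]

/-- **[MW] IV.3.12 (a) FOR `M(z, χ)` AT THE CM PAIR FROM THE CONTINUED TRUNCATED FAMILY IN `L²(X, μ)` AND FILE 1's RELATION ON THE TUBE** (the `(χ,τ)` twin of ★
`poleControl_continued_cm_two_of_family_on`): `D₁ ⊆ D⁺` open preconnected ⊇ two sub-tube boxes `O₁`, `O₂'`; bracket letters as in §2; a measure `μ` on the automorphic quotient `X` of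
`U(1,1)_{L∕L⁺}`, a measure `ν` on `N(𝔸)`, a set `𝓕`, `T ≥ 1`, a section `φ`; `F : ℂ → L²(X, μ)` holomorphic on `D₁` with `F z = [Λ^T E(φH^z)]` a.e. for `z ∈ D₁`, `Re z > 1`
(`hFtube`); and THE SOCKET `h4` — the `(χ, τ)` Maass–Selberg relation `∫_X Λ^TE(φ, z)·conj Λ^TE(φ, z′) dμ = R(z, z′; B)` on the sub-tube `1 < Re z′ < Re z` (FILE 1,
K2E1-p14, any bracket bytes).  THEN (a1)∧(a2)∧(a3) for `b` at every `z ∈ D₁`. [cite: MoeglinWaldspurger1995, IV.2.3, IV.3.12 (a)] [cite: Arthur1980TraceFormulaII, §4] -/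
theorem poleControl_continued_chi_cm_two_of_truncatedFamily_on' {D₁ : Set ℂ} (hD₁ : IsOpen D₁) (hD₁c : IsPreconnected D₁) (hD₁sub : D₁ ⊆ {z : ℂ | 1 / 2 < z.re ∧ 0 < z.im})
    {O₁ O₂' : Set ℂ} (hO₁ : IsOpen O₁) (hO₁ne : O₁.Nonempty) (hO₁D : O₁ ⊆ D₁) (hO₂' : IsOpen O₂') (hO₂'ne : O₂'.Nonempty) (hO₂'D : O₂' ⊆ D₁)
    (hsep : ∀ z ∈ O₁, ∀ z' ∈ O₂', 1 < z'.re ∧ z'.re < z.re)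
    (μ : Measure (quasiSplit (↥(maximalRealSubfield L)) L (IsCMField.complexConj L) 2).automorphicQuotient)
    (ν : Measure ↥(adelicUnipotent (↥(maximalRealSubfield L)) L (IsCMField.complexConj L) 2)) (𝓕 : Set ↥(adelicUnipotent (↥(maximalRealSubfield L)) L (IsCMField.complexConj L) 2))
    {T : ℝ≥0} (hT : 1 ≤ T) {cμ K : ℝ} (hcμ : 0 < cμ) (hK : 0 < K) {a : ℝ} (ha : 0 < a) {b : ℂ → ℝ} (hb : ∀ z ∈ D₁, 0 ≤ b z)
    {B₁ : ℂ} {B₂ B₃ : ℂ → ℂ} {B₄ : ℂ → ℂ → ℂ} (hB₁ : B₁ = ((a : ℝ) : ℂ)) (hB₂ : DifferentiableOn ℂ (fun w : ℂ => B₂ (conj w)) {w : ℂ | conj w ∈ D₁}) (hB₃ : DifferentiableOn ℂ B₃ D₁)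
    (hB₃₂ : ∀ z ∈ D₁, B₃ z = conj (B₂ z)) (hB₄₁ : ∀ z' ∈ D₁, DifferentiableOn ℂ (fun z : ℂ => B₄ z z') D₁)
    (hB₄₂ : ∀ z ∈ D₁, DifferentiableOn ℂ (fun w : ℂ => B₄ z (conj w)) {w : ℂ | conj w ∈ D₁}) (hB₄d : ∀ z ∈ D₁, B₄ z z = ((b z : ℝ) : ℂ))
    (hCS : ∀ z ∈ D₁, ‖B₂ z‖ ^ 2 ≤ a * b z)
    (φ : (quasiSplit (↥(maximalRealSubfield L)) L (IsCMField.complexConj L) 2).Adelic → ℂ)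
    (F : ℂ → Lp ℂ 2 μ) (hFd : DifferentiableOn ℂ F D₁)
    (hFtube : ∀ z ∈ D₁, 1 < z.re → ((F z : Lp ℂ 2 μ) : (quasiSplit (↥(maximalRealSubfield L)) L (IsCMField.complexConj L) 2).automorphicQuotient → ℂ) =ᵐ[μ] (quasiSplit (↥(maximalRealSubfield L)) L (IsCMField.complexConj L) 2).quotFun (truncation ν 𝓕 T (eisensteinSeriesU (flatSectionU φ z))))
    (h4 : ∀ z z' : ℂ, 1 < z'.re → z'.re < z.re →
      ∫ x, (quasiSplit (↥(maximalRealSubfield L)) L (IsCMField.complexConj L) 2).quotFun (truncation ν 𝓕 T (eisensteinSeriesU (flatSectionU φ z))) x * conj ((quasiSplit (↥(maximalRealSubfield L)) L (IsCMField.complexConj L) 2).quotFun (truncation ν 𝓕 T (eisensteinSeriesU (flatSectionU φ z'))) x) ∂μ =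
      ((cμ : ℝ) : ℂ) * (((K : ℝ) : ℂ) *
        ((((T : ℝ) : ℂ) ^ (z + conj z' - 1) / (z + conj z' - 1)) * B₁
          + (((T : ℝ) : ℂ) ^ (z - conj z') / (z - conj z')) * B₂ z'
          - (((T : ℝ) : ℂ) ^ (-(z - conj z')) / (z - conj z')) * B₃ z
          - (((T : ℝ) : ℂ) ^ (-(z + conj z' - 1)) / (z + conj z' - 1)) * B₄ z z')))
    {z : ℂ} (hz : z ∈ D₁) :
    Real.sqrt (b z) ≤ (z.re - 1 / 2) * (T : ℝ) ^ (2 * (z.re - 1 / 2)) * Real.sqrt a / |z.im| +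
        Real.sqrt ((z.re - 1 / 2) ^ 2 * (T : ℝ) ^ (4 * (z.re - 1 / 2)) * a / z.im ^ 2 + a * (T : ℝ) ^ (4 * (z.re - 1 / 2))) ∧
      (∀ {x₁ x₂ η : ℝ}, 0 < x₁ → (z.re - 1 / 2) ∈ Set.Icc x₁ x₂ → 0 < η → η ≤ |z.im| →
        b z ≤ (x₂ * (T : ℝ) ^ (2 * x₂) * Real.sqrt a / η + Real.sqrt (x₂ ^ 2 * (T : ℝ) ^ (4 * x₂) * a / η ^ 2 + a * (T : ℝ) ^ (4 * x₂))) ^ 2) ∧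
      (|z.im| ≤ 1 → b z ≤ ((z.re - 1 / 2) * (T : ℝ) ^ (2 * (z.re - 1 / 2)) * Real.sqrt a +
        Real.sqrt ((z.re - 1 / 2) ^ 2 * (T : ℝ) ^ (4 * (z.re - 1 / 2)) * a + a * (T : ℝ) ^ (4 * (z.re - 1 / 2)))) ^ 2 / z.im ^ 2) := by
  have hraw : ∀ z ∈ D₁, ∀ z' ∈ D₁, 1 < z.re → 1 < z'.re →
      ⟪F z', F z⟫_ℂ = ∫ x, (quasiSplit (↥(maximalRealSubfield L)) L (IsCMField.complexConj L) 2).quotFun (truncation ν 𝓕 T (eisensteinSeriesU (flatSectionU φ z))) x * conj ((quasiSplit (↥(maximalRealSubfield L)) L (IsCMField.complexConj L) 2).quotFun (truncation ν 𝓕 T (eisensteinSeriesU (flatSectionU φ z'))) x) ∂μ := by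
    intro z hz z' hz' hz1 hz'1
    rw [MeasureTheory.L2.inner_def]
    refine integral_congr_ae ?_
    filter_upwards [hFtube z hz hz1, hFtube z' hz' hz'1] with x hx hx'
    rw [hx, hx', RCLike.inner_apply, mul_comm]
  have hrel : ∀ z ∈ D₁, ∀ z' ∈ D₁, 1 < z'.re → z'.re < z.re →
      ⟪F z', F z⟫_ℂ = ((cμ : ℝ) : ℂ) * (((K : ℝ) : ℂ) *
        ((((T : ℝ) : ℂ) ^ (z + conj z' - 1) / (z + conj z' - 1)) * B₁
          + (((T : ℝ) : ℂ) ^ (z - conj z') / (z - conj z')) * B₂ z'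
          - (((T : ℝ) : ℂ) ^ (-(z - conj z')) / (z - conj z')) * B₃ z
          - (((T : ℝ) : ℂ) ^ (-(z + conj z' - 1)) / (z + conj z' - 1)) * B₄ z z')) := by
    intro z hz z' hz' h1 h2
    rw [hraw z hz z' hz' (h1.trans h2) h1]
    exact h4 z z' h1 h2
  exact poleControl_continued_chi_cm_two_of_family_on' hD₁ hD₁c hD₁sub hO₁ hO₁ne hO₁D hO₂' hO₂'ne hO₂'D hsep (T := (T : ℝ)) (by exact_mod_cast hT) hcμ hK ha hb hB₁ hB₂ hB₃ hB₃₂ hB₄₁ hB₄₂ hB₄d hCS F hFd hrel hz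

end Family

/-! ## §3 The off-dual model, general boxes -/

section OffDual

variable {V : Type*} [NormedAddCommGroup V] [InnerProductSpace ℂ V] {V' : Type*} [NormedAddCommGroup V'] [InnerProductSpace ℂ V']

/-- **OFF-DUAL MODEL (`χ ≠ χʷ`): the two-term relation gives a `y`-FREE bound — NO POLE AT ALL on `D₁` — GENERAL-BOX EDITION.**  `φ ∈ V ∖ 0`, `ψ : ℂ → V′` holomorphic on `D₁` into a second inner-product
space (the continued `M(z, χ)φ ∈ V(χʷ, τ, U)`), real `κ, m` (no sign needed); `F : ℂ → H` holomorphic on `D₁` with `⟪F z′, F z⟫ = cμ·K·(T^{s₁}∕s₁·κm⟪φ, φ⟫ − T^{−s₁}∕s₁·κm⟪ψ z′, ψ z⟫)` on the sub-tube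
(the cross brackets vanish by orthogonality of `χ ≠ χʷ`).  THEN `κm‖ψ z‖² ≤ T^{4(Re z − ½)}·κm‖φ‖²` at every `z ∈ D₁` — uniformly in `y = Im z` (§1 `diag_eq_fourBracket_of_pairing_on'` with
`B₂ = B₃ = 0`, ★ `pairing_of_differentiableOn`, then `le_of_twoTerm` on the diagonal). [cite: MoeglinWaldspurger1995, IV.1.11, IV.3.12 (a)] [cite: Arthur1980TraceFormulaII, §4] -/
theorem normSq_le_of_family_offDual_on' {D₁ : Set ℂ} (hD₁ : IsOpen D₁) (hD₁c : IsPreconnected D₁) (hD₁sub : D₁ ⊆ {z : ℂ | 1 / 2 < z.re ∧ 0 < z.im})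
    {O₁ O₂' : Set ℂ} (hO₁ : IsOpen O₁) (hO₁ne : O₁.Nonempty) (hO₁D : O₁ ⊆ D₁) (hO₂' : IsOpen O₂') (hO₂'ne : O₂'.Nonempty) (hO₂'D : O₂' ⊆ D₁)
    (hsep : ∀ z ∈ O₁, ∀ z' ∈ O₂', 1 < z'.re ∧ z'.re < z.re)
    {T cμ K : ℝ} (hT : 1 ≤ T) (hcμ : 0 < cμ) (hK : 0 < K) (κ m : ℝ) (φ : V) {ψ : ℂ → V'} (hψ : DifferentiableOn ℂ ψ D₁)
    {H : Type*} [NormedAddCommGroup H] [InnerProductSpace ℂ H] (F : ℂ → H) (hFd : DifferentiableOn ℂ F D₁)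
    (hrel : ∀ z ∈ D₁, ∀ z' ∈ D₁, 1 < z'.re → z'.re < z.re →
      ⟪F z', F z⟫_ℂ = ((cμ : ℝ) : ℂ) * (((K : ℝ) : ℂ) *
        ((((T : ℝ) : ℂ) ^ (z + conj z' - 1) / (z + conj z' - 1)) * (((κ : ℝ) : ℂ) * (((m : ℝ) : ℂ) * ⟪φ, φ⟫_ℂ))
          - (((T : ℝ) : ℂ) ^ (-(z + conj z' - 1)) / (z + conj z' - 1)) * (((κ : ℝ) : ℂ) * (((m : ℝ) : ℂ) * ⟪ψ z', ψ z⟫_ℂ)))))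
    {z : ℂ} (hz : z ∈ D₁) :
    κ * m * ‖ψ z‖ ^ 2 ≤ T ^ (4 * (z.re - 1 / 2)) * (κ * m * ‖φ‖ ^ 2) := by
  have hT0 : 0 < T := lt_of_lt_of_le one_pos hT
  -- the relation in four-bracket shape with `B₂ = B₃ = 0`
  have hrel' : ∀ z ∈ D₁, ∀ z' ∈ D₁, 1 < z'.re → z'.re < z.re →
      ⟪F z', F z⟫_ℂ = ((cμ : ℝ) : ℂ) * (((K : ℝ) : ℂ) *
        ((((T : ℝ) : ℂ) ^ (z + conj z' - 1) / (z + conj z' - 1)) * (((κ : ℝ) : ℂ) * (((m : ℝ) : ℂ) * ⟪φ, φ⟫_ℂ))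
          + (((T : ℝ) : ℂ) ^ (z - conj z') / (z - conj z')) * (fun _ : ℂ => (0 : ℂ)) z'
          - (((T : ℝ) : ℂ) ^ (-(z - conj z')) / (z - conj z')) * (fun _ : ℂ => (0 : ℂ)) z
          - (((T : ℝ) : ℂ) ^ (-(z + conj z' - 1)) / (z + conj z' - 1)) * (((κ : ℝ) : ℂ) * (((m : ℝ) : ℂ) * ⟪ψ z', ψ z⟫_ℂ)))) := by
    intro z hz z' hz' h1 h2
    rw [hrel z hz z' hz' h1 h2]
    ring
  obtain ⟨hΦ₁, hΦ₂, hQ⟩ := pairing_of_differentiableOn hD₁ hFd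
  have hB₄₁ : ∀ z' ∈ D₁, DifferentiableOn ℂ (fun z : ℂ => ((κ : ℝ) : ℂ) * (((m : ℝ) : ℂ) * ⟪ψ z', ψ z⟫_ℂ)) D₁ := fun z' _ =>
    (((innerSL ℂ (ψ z')).differentiable.comp_differentiableOn hψ).const_mul _).const_mul _
  have hB₄₂ : ∀ z ∈ D₁, DifferentiableOn ℂ (fun w : ℂ => ((κ : ℝ) : ℂ) * (((m : ℝ) : ℂ) * ⟪ψ (conj w), ψ z⟫_ℂ)) {w : ℂ | conj w ∈ D₁} := fun z _ =>
    ((differentiableOn_inner_conj_comp hD₁ hψ (ψ z)).const_mul _).const_mul _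
  have hdiag := diag_eq_fourBracket_of_pairing_on' hD₁ hD₁c hD₁sub hO₁ hO₁ne hO₁D hO₂' hO₂'ne hO₂'D hsep hT0 (cμ := cμ) (K := K)
    (B₁ := ((κ : ℝ) : ℂ) * (((m : ℝ) : ℂ) * ⟪φ, φ⟫_ℂ)) (B₂ := fun _ : ℂ => (0 : ℂ)) (B₃ := fun _ : ℂ => (0 : ℂ))
    (B₄ := fun z z' => ((κ : ℝ) : ℂ) * (((m : ℝ) : ℂ) * ⟪ψ z', ψ z⟫_ℂ)) (differentiableOn_const (0 : ℂ)) (differentiableOn_const (0 : ℂ)) hB₄₁ hB₄₂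
    (Φ := fun z z' => ⟪F z', F z⟫_ℂ) hΦ₁ hΦ₂ hrel' hz
  obtain ⟨hQ0, hQeq⟩ := hQ z hz
  simp only [mul_zero, add_zero, sub_zero] at hdiag
  rw [hQeq, real_mul_inner_self κ m φ, real_mul_inner_self κ m (ψ z)] at hdiag
  have hx : 0 < z.re - 1 / 2 := by linarith [(hD₁sub hz).1]
  exact le_of_twoTerm hcμ hK hT0 hx hQ0 (add_conj_sub_one_eq z).1 hdiag

end OffDual

end Summit.HodgeConjecture.HodgeConjecture.Cruxes.H413.K2E1ChiMaassSelbergContinuedOnBoxesCMTwo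

end
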